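import Literature.Analysis.FluidPDE.PassiveScalarClassicalEnergy
import Literature.Analysis.FluidPDE.CheskidovAssemblyTools
import Literature.Analysis.FunctionSpaces.TorusLerayHelmholtz
import HarnessLib

/-!
# Cheskidov's scalar estimates, I: viscous–inviscid closeness (arXiv:2311.04182, §4, (4.3))

Topic `Literature/Analysis/FluidPDE` (support file for the proof of
`Literature.Analysis.FluidPDE.cheskidov_total_dissipation_family`, Cheskidov 2023, §4). The first
estimate of §4 compares, for one and the same smooth divergence-free drift `v`, the classical
solution `θ` of the advection–diffusion equation `∂ₜθ + v·∇θ = νΔθ` with the classical solution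
`ρ` of the transport equation `∂ₜρ + v·∇ρ = 0` from the same datum, `θ(a) = ρ(a)`:
Cheskidov 2023, (4.3),
`sup_{t ∈ [0,T]} ‖θ(t) - ρ(t)‖²_{L²} ≤ (2ν∫₀ᵀ‖∇ρ‖²)^{1/2} (2ν∫₀ᵀ‖∇θ‖²)^{1/2} ≤ (2ν∫₀ᵀ‖∇ρ‖²)^{1/2}`.
We prove the slightly sharper (for small right-hand sides) form that the same one-line energy
argument gives,

  `‖θ(t) - ρ(t)‖²_{L²} ≤ (ν/2) ∫ₐᵗ ‖∇ρ(s)‖²_{L²} ds`   (`t ∈ [a, b] ⊆ S`),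

`Torus.IsClassicalScalarTransportOn.integral_sub_sq_le`: with `w = θ - ρ`,
`∂ₜw + v·∇w = νΔθ`, so `d/dt ‖w‖² = 2ν∫ wΔθ = -2ν∫⟪∇w, ∇w + ∇ρ⟫ ≤ -2ν‖∇w‖² + 2ν‖∇w‖‖∇ρ‖ ≤ (ν/2)‖∇ρ‖²`
(the transport term `∫ w ⟪v, ∇w⟫` vanishes by incompressibility), and one integrates in time.
Only the inviscid enstrophy `∫‖∇ρ‖²` — explicit for the glued Alberti–Crippa–Mazzucato profiles
— enters the right-hand side, which is how (4.3) is used in (4.4)–(4.5) and (6.4) of the source.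

## References

* A. Cheskidov, *Dissipation anomaly and anomalous dissipation in incompressible fluid flows*,
  arXiv:2311.04182 (2023), §4, (4.3)–(4.5).
-/

open MeasureTheory Set Filter
open _root_.Topology
open scoped InnerProductSpace ContDiff ENNReal NNReal

noncomputable section

namespace Literature.Analysis.FluidPDE

namespace Torus

variable {d : Type*} [Fintype d] [DecidableEq d]

/-! ## Green's first identity in gradient form -/

/-- `⟪∇a(x), ∇b(x)⟫ = ∑ᵢ ∂ᵢa(x) ∂ᵢb(x)` for `C¹` scalars on the torus. [folklore] -/
theorem inner_gradient_gradient_eq_sum {a b : UnitAddTorus d → ℝ} (ha : FunctionSpaces.Torus.IsContDiff 1 a)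
    (hb : FunctionSpaces.Torus.IsContDiff 1 b) (x : UnitAddTorus d) :
    ⟪FunctionSpaces.Torus.gradient a x, FunctionSpaces.Torus.gradient b x⟫_ℝ =
      ∑ i, FunctionSpaces.Torus.partialDeriv i a x * FunctionSpaces.Torus.partialDeriv i b x := by
  rw [PiLp.inner_apply]
  refine Finset.sum_congr rfl fun i _ => ?_
  rw [FunctionSpaces.Torus.gradient_apply ha, FunctionSpaces.Torus.gradient_apply hb]
  simp [mul_comm]

/-- **Green's first identity on the torus**, gradient form: `∫ a Δb = -∫ ⟪∇a, ∇b⟫` for smooth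
scalars (Evans 2010, App. C.2, Thm. 3 (i)/(ii), empty boundary). [cite: Evans2010, App. C.2 Thm. 3] -/
theorem integral_mul_laplacian_eq_neg_integral_inner_gradient {a b : UnitAddTorus d → ℝ}
    (ha : FunctionSpaces.Torus.IsSmooth a) (hb : FunctionSpaces.Torus.IsSmooth b) :
    ∫ x, a x * FunctionSpaces.Torus.laplacian b x =
      -∫ x, ⟪FunctionSpaces.Torus.gradient a x, FunctionSpaces.Torus.gradient b x⟫_ℝ := by
  rw [FunctionSpaces.Torus.integral_mul_laplacian_eq_neg_sum ha hb]
  congr 1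
  simp_rw [inner_gradient_gradient_eq_sum (ha.isContDiff (by simp)) (hb.isContDiff (by simp))]
  exact (integral_finsetSum _ fun i _ =>
    ((ha.partialDeriv i).smul' (hb.partialDeriv i)).integrable).symm

omit [DecidableEq d] in
/-- The elementary inequality behind (4.3): `-∫⟪∇w, ∇w⟫ - ∫⟪∇w, ∇ρ⟫ ≤ ¼ ∫‖∇ρ‖²` for smooth
scalars (Cauchy–Schwarz and `-x² + xy ≤ y²/4`). [cite: Cheskidov2023, §4 (4.3)] -/
theorem neg_scalarGradNormSq_sub_integral_inner_le {w ρ : UnitAddTorus d → ℝ}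
    (hw : FunctionSpaces.Torus.IsSmooth w) (hρ : FunctionSpaces.Torus.IsSmooth ρ) :
    -scalarGradNormSq w - ∫ x, ⟪FunctionSpaces.Torus.gradient w x, FunctionSpaces.Torus.gradient ρ x⟫_ℝ ≤
      scalarGradNormSq ρ / 4 := by
  have hcs := abs_integral_inner_le_sqrt_mul_sqrt (hw.gradient.memLp 2) (hρ.gradient.memLp 2)
  rw [abs_le] at hcs
  set X := Real.sqrt (∫ x, ‖FunctionSpaces.Torus.gradient w x‖ ^ 2) with hX
  set Y := Real.sqrt (∫ x, ‖FunctionSpaces.Torus.gradient ρ x‖ ^ 2) with hY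
  have hX2 : X ^ 2 = scalarGradNormSq w := Real.sq_sqrt (scalarGradNormSq_nonneg w)
  have hY2 : Y ^ 2 = scalarGradNormSq ρ := Real.sq_sqrt (scalarGradNormSq_nonneg ρ)
  nlinarith [hcs.1, sq_nonneg (X - Y / 2)]

/-! ## Viscous–inviscid closeness (Cheskidov 2023, (4.3)) -/

namespace IsClassicalScalarTransportOn

variable {S : Set ℝ} {ν : ℝ} {v : ℝ → UnitAddTorus d → EuclideanSpace ℝ d}
  {θ ρ : ℝ → UnitAddTorus d → ℝ}

/-- **The energy inequality for the difference** `w = θ - ρ` of a viscous (`ν ≥ 0`) and an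
inviscid classical passive scalar driven by the same divergence-free drift on a convex time set:
`d/dt ‖w(t)‖²_{L²} ≤ (ν/2)‖∇ρ(t)‖²_{L²}` (as a bound on the one-sided derivative
`∫ ∂ₜ(w²)`). From `∂ₜw + v·∇w = νΔθ`: `∫∂ₜ(w²) = 2ν∫wΔθ = -2ν(‖∇w‖² + ∫⟪∇w,∇ρ⟫) ≤ (ν/2)‖∇ρ‖²`
(Cheskidov 2023, proof of (4.3)). [cite: Cheskidov2023, §4 (4.3)] -/
theorem integral_timeDerivWithin_sub_sq_le (hθ : IsClassicalScalarTransportOn S ν v θ)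
    (hρ : IsClassicalScalarTransportOn S 0 v ρ) (hν : 0 ≤ ν) (hU : UniqueDiffOn ℝ S) {t : ℝ}
    (ht : t ∈ S) :
    ∫ x, FunctionSpaces.Torus.timeDerivWithin S (fun s x => (θ s x - ρ s x) * (θ s x - ρ s x)) t x ≤
      ν / 2 * scalarGradNormSq (ρ t) := by
  have hθs := hθ.smooth_scalar
  have hρs := hρ.smooth_scalar
  have hws : FunctionSpaces.Torus.IsSmoothSpaceTimeOn S (fun s x => θ s x - ρ s x) := hθs.sub hρs
  have hθt : FunctionSpaces.Torus.IsSmooth (θ t) := hθs.isSmooth_slice ht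
  have hρt : FunctionSpaces.Torus.IsSmooth (ρ t) := hρs.isSmooth_slice ht
  have hvt : FunctionSpaces.Torus.IsSmooth (v t) := hθ.smooth_velocity.isSmooth_slice ht
  have hwt : FunctionSpaces.Torus.IsSmooth (θ t - ρ t) := hθt.sub hρt
  -- the time derivative of `w²` and of `w`
  have hdw : ∀ x, FunctionSpaces.Torus.timeDerivWithin S (fun s x => θ s x - ρ s x) t x =
      ν * FunctionSpaces.Torus.laplacian (θ t) x - ⟪v t x, FunctionSpaces.Torus.gradient (θ t - ρ t) x⟫_ℝ := by
    intro x
    have h1 : HasDerivWithinAt (fun s => θ s x - ρ s x)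
        (FunctionSpaces.Torus.timeDerivWithin S θ t x - FunctionSpaces.Torus.timeDerivWithin S ρ t x) S t :=
      (hθs.hasDerivWithinAt_slice ht x).sub (hρs.hasDerivWithinAt_slice ht x)
    rw [FunctionSpaces.Torus.timeDerivWithin, h1.derivWithin (hU t ht)]
    have eθ := hθ.transport t ht x
    have eρ := hρ.transport t ht x
    rw [zero_mul] at eρ
    rw [FunctionSpaces.Torus.gradient_sub (hθt.isContDiff (by simp)) (hρt.isContDiff (by simp)), inner_sub_right]
    linarith
  have hdw2 : ∀ x, FunctionSpaces.Torus.timeDerivWithin S (fun s x => (θ s x - ρ s x) * (θ s x - ρ s x)) t x =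
      2 * (ν * ((θ t x - ρ t x) * FunctionSpaces.Torus.laplacian (θ t) x) -
        (θ t - ρ t) x * ⟪v t x, FunctionSpaces.Torus.gradient (θ t - ρ t) x⟫_ℝ) := by
    intro x
    have h1 : HasDerivWithinAt (fun s => (θ s x - ρ s x) * (θ s x - ρ s x))
        (FunctionSpaces.Torus.timeDerivWithin S (fun s x => θ s x - ρ s x) t x * (θ t x - ρ t x) +
          (θ t x - ρ t x) * FunctionSpaces.Torus.timeDerivWithin S (fun s x => θ s x - ρ s x) t x) S t :=
      (hws.hasDerivWithinAt_slice ht x).mul (hws.hasDerivWithinAt_slice ht x)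
    rw [FunctionSpaces.Torus.timeDerivWithin, h1.derivWithin (hU t ht), hdw x, Pi.sub_apply]
    ring
  -- integrate
  have i1 : Integrable (fun x => (θ t x - ρ t x) * FunctionSpaces.Torus.laplacian (θ t) x) volume :=
    (hwt.smul' hθt.laplacian).integrable
  have i2 : Integrable (fun x => (θ t - ρ t) x * ⟪v t x, FunctionSpaces.Torus.gradient (θ t - ρ t) x⟫_ℝ) volume :=
    (hwt.smul' (hvt.inner hwt.gradient)).integrable
  simp_rw [hdw2]
  rw [integral_const_mul, integral_sub (i1.const_mul ν) i2, integral_const_mul,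
    integral_mul_inner_gradient_self_eq_zero hvt (hθ.divFree t ht) hwt, sub_zero]
  have hlap : ∫ x, (θ t x - ρ t x) * FunctionSpaces.Torus.laplacian (θ t) x =
      -scalarGradNormSq (θ t - ρ t) -
        ∫ x, ⟪FunctionSpaces.Torus.gradient (θ t - ρ t) x, FunctionSpaces.Torus.gradient (ρ t) x⟫_ℝ := by
    have h1 := integral_mul_laplacian_eq_neg_integral_inner_gradient hwt hθt
    have hsplit : ∀ x, ⟪FunctionSpaces.Torus.gradient (θ t - ρ t) x, FunctionSpaces.Torus.gradient (θ t) x⟫_ℝ =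
        ⟪FunctionSpaces.Torus.gradient (θ t - ρ t) x, FunctionSpaces.Torus.gradient (θ t - ρ t) x⟫_ℝ +
          ⟪FunctionSpaces.Torus.gradient (θ t - ρ t) x, FunctionSpaces.Torus.gradient (ρ t) x⟫_ℝ := by
      intro x
      rw [FunctionSpaces.Torus.gradient_sub (hθt.isContDiff (by simp)) (hρt.isContDiff (by simp)),
        ← inner_add_right, sub_add_cancel]
    have e1 : (fun x => (θ t - ρ t) x * FunctionSpaces.Torus.laplacian (θ t) x) =
        fun x => (θ t x - ρ t x) * FunctionSpaces.Torus.laplacian (θ t) x := rfl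
    rw [e1] at h1
    rw [h1]
    simp_rw [hsplit]
    rw [integral_add (hwt.gradient.inner hwt.gradient).integrable (hwt.gradient.inner hρt.gradient).integrable]
    simp only [scalarGradNormSq, real_inner_self_eq_norm_sq]
    ring
  rw [hlap]
  have hkey := neg_scalarGradNormSq_sub_integral_inner_le hwt hρt
  nlinarith

/-- **Viscous–inviscid closeness** (Cheskidov 2023, (4.3), in the sharpened form
`‖θ(t) - ρ(t)‖²_{L²} ≤ (ν/2)∫ₐᵗ‖∇ρ(s)‖²_{L²} ds = ½ · scalarDissipation ν ρ a t`): for `ν ≥ 0`, a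
classical solution `θ` of `∂ₜθ + v·∇θ = νΔθ` and a classical solution `ρ` of `∂ₜρ + v·∇ρ = 0`
with the same drift on `S ⊇ [a, b]` and the same datum `θ(a) = ρ(a)` stay `L²`-close as long as
the inviscid enstrophy `ν∫‖∇ρ‖²` is small. (The source states
`sup‖θ-ρ‖² ≤ (2ν∫‖∇ρ‖²)^{1/2}(2ν∫‖∇θ‖²)^{1/2}`, obtained from the same identity by Cauchy–Schwarz
in time; the present bound follows from `-2ν‖∇w‖² + 2ν‖∇w‖‖∇ρ‖ ≤ (ν/2)‖∇ρ‖²` and needs no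
information on `θ`.) [cite: Cheskidov2023, §4 (4.3)] -/
theorem integral_sub_sq_le (hθ : IsClassicalScalarTransportOn S ν v θ)
    (hρ : IsClassicalScalarTransportOn S 0 v ρ) (hν : 0 ≤ ν) {a b : ℝ} (hI : Icc a b ⊆ S)
    (h0 : θ a = ρ a) {t : ℝ} (ht : t ∈ Icc a b) :
    ∫ x, (θ t x - ρ t x) ^ 2 ≤ scalarDissipation ν ρ a t / 2 := by
  rcases eq_or_lt_of_le ht.1 with rfl | hat
  · simp [h0, scalarDissipation]
  have hab : a < b := hat.trans_le ht.2
  have hθ' := hθ.restrict_Icc hab hI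
  have hρ' := hρ.restrict_Icc hab hI
  have hconv : Convex ℝ (Icc a b) := convex_Icc a b
  have hU : UniqueDiffOn ℝ (Icc a b) := uniqueDiffOn_Icc hab
  have hws : FunctionSpaces.Torus.IsSmoothSpaceTimeOn (Icc a b) (fun s x => θ s x - ρ s x) :=
    hθ'.smooth_scalar.sub hρ'.smooth_scalar
  have hφ : FunctionSpaces.Torus.IsSmoothSpaceTimeOn (Icc a b) (fun s x => (θ s x - ρ s x) * (θ s x - ρ s x)) :=
    hws.mul hws
  -- `E(s) = ∫ w(s)²`, its derivative `D(s) = ∫ ∂ₜ(w²)(s)` and the bound `D ≤ (ν/2)‖∇ρ‖²`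
  set D : ℝ → ℝ := fun s => ∫ x, FunctionSpaces.Torus.timeDerivWithin (Icc a b)
    (fun s x => (θ s x - ρ s x) * (θ s x - ρ s x)) s x with hD
  have hderiv : ∀ s ∈ Icc a b, HasDerivWithinAt (fun σ => ∫ x, (θ σ x - ρ σ x) * (θ σ x - ρ σ x)) (D s) (Icc a b) s :=
    fun s hs => hφ.hasDerivWithinAt_integral hconv hs
  have hDc : ContinuousOn D (Icc a b) := (hφ.timeDerivWithin hU).continuousOn_integral hconv
  have hGc : ContinuousOn (fun s => scalarGradNormSq (ρ s)) (Icc a b) := hρ'.continuousOn_scalarGradNormSq hconv hU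
  have hta : Icc a t ⊆ Icc a b := Icc_subset_Icc le_rfl ht.2
  have hDi : IntervalIntegrable D volume a t := ((hDc.mono hta).mono (uIcc_of_le ht.1).subset).intervalIntegrable
  have hGi : IntervalIntegrable (fun s => ν / 2 * scalarGradNormSq (ρ s)) volume a t :=
    (((hGc.mono hta).mono (uIcc_of_le ht.1).subset).intervalIntegrable).const_mul _
  have hFTC : ∫ s in a..t, D s = (∫ x, (θ t x - ρ t x) * (θ t x - ρ t x)) - ∫ x, (θ a x - ρ a x) * (θ a x - ρ a x) :=
    intervalIntegral.integral_eq_sub_of_hasDerivAt_of_le ht.1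
      (fun s hs => ((hderiv s (hta hs)).continuousWithinAt).mono hta)
      (fun s hs => (hderiv s (hta (Ioo_subset_Icc_self hs))).hasDerivAt (Icc_mem_nhds hs.1 (hs.2.trans_le ht.2)))
      hDi
  have hmono : ∫ s in a..t, D s ≤ ∫ s in a..t, ν / 2 * scalarGradNormSq (ρ s) :=
    intervalIntegral.integral_mono_on ht.1 hDi hGi fun s hs =>
      hθ'.integral_timeDerivWithin_sub_sq_le hρ' hν hU (hta hs)
  have h0' : ∫ x, (θ a x - ρ a x) * (θ a x - ρ a x) = 0 := by simp [h0]
  rw [intervalIntegral.integral_const_mul] at hmono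
  have hsq : ∫ x, (θ t x - ρ t x) ^ 2 = ∫ x, (θ t x - ρ t x) * (θ t x - ρ t x) := by simp_rw [sq]
  rw [hsq, scalarDissipation]
  linarith

/-- The closeness bound on a whole interval: `sup_{t ∈ [a,b]} ‖θ(t) - ρ(t)‖²_{L²} ≤ ½ νͅ∫ₐᵇ‖∇ρ‖²`
(monotonicity of the dissipation in the upper limit; Cheskidov 2023, (4.3) with `T = b`). [cite: Cheskidov2023, §4 (4.3)] -/
theorem integral_sub_sq_le_of_mem_Icc (hθ : IsClassicalScalarTransportOn S ν v θ)
    (hρ : IsClassicalScalarTransportOn S 0 v ρ) (hν : 0 ≤ ν) {a b : ℝ} (hI : Icc a b ⊆ S)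
    (h0 : θ a = ρ a) {t : ℝ} (ht : t ∈ Icc a b) :
    ∫ x, (θ t x - ρ t x) ^ 2 ≤ scalarDissipation ν ρ a b / 2 := by
  refine (hθ.integral_sub_sq_le hρ hν hI h0 ht).trans ?_
  rcases eq_or_lt_of_le (ht.1.trans ht.2) with hab | hab
  · subst hab
    have : t = a := le_antisymm ht.2 ht.1
    subst this
    simp
  have hρ' := hρ.restrict_Icc hab hI
  have hGc : ContinuousOn (fun s => scalarGradNormSq (ρ s)) (Icc a b) :=
    hρ'.continuousOn_scalarGradNormSq (convex_Icc a b) (uniqueDiffOn_Icc hab)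
  have hGi : IntervalIntegrable (fun s => scalarGradNormSq (ρ s)) volume a b :=
    (hGc.mono (uIcc_of_le hab.le).subset).intervalIntegrable
  have hmono := intervalIntegral.integral_mono_interval (μ := volume) (f := fun s => scalarGradNormSq (ρ s))
    (c := a) (d := b) (a := a) (b := t) le_rfl ht.1 ht.2
    (Eventually.of_forall fun s => scalarGradNormSq_nonneg _) hGi
  simp only [scalarDissipation]
  gcongr

end IsClassicalScalarTransportOn

end Torus

end Literature.Analysis.FluidPDE

end
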